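import Literature.NumberTheory.Automorphic.BurnsideKolchin
import Literature.NumberTheory.Automorphic.ReductiveDualGLn
import Literature.NumberTheory.Automorphic.LinearAlgebraicGroupsProofs
import HarnessLib

/-!
# `GL n` is a connected reductive group with maximal torus `𝔻ₙ`; its root datum (Springer 7.4.7 (1))
(trunk T-AUTOMORPHIC, G25 AutomorphicL)

Companion to `ReductiveDualGLn.lean` (lang.S13 (b) for `(GL n, 𝔻ₙ)` as an instance of the named
fact `Literature.NumberTheory.Automorphic.exists_isRootDatumOf`, i.e. under the hypotheses `IsConnectedReductive ⊤`,
`IsMaximalTorusIn 𝔻ₙ ⊤`) and `BurnsideKolchin.lean` (Kolchin's theorem). Here those hypotheses are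
**discharged** for the general linear group over an algebraically closed field, in the
`k`-points vocabulary of `LinearAlgebraicGroups.lean`:

* `isReductiveSubgroup_top` — **`GL n` is reductive** (Springer 7.4.7 (1) (b), exercise:
  "*show that `G` is reductive*"): a normal subgroup of unipotent matrices is trivial. By
  Kolchin's theorem (`IsUnipotentSubgroup.exists_mulVec_eq`) its space of common fixed vectors is
  non-zero; being stable under `GL n` (normality), it is stable under the elementary matrices
  `E_{ij} = (1 + E_{ij}) - 1` and so is all of `kⁿ`.
* `isZConnected_top` — **`GL n` is connected** (Springer 2.2.2 (1)): a finite-index subgroup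
  contains a normal one `N`; `N ⊇ 𝔻ₙ` (`eq_diagonalSubgroup_of_finiteIndex`: `𝔻ₙ ≅ (kˣ)ⁿ` is
  divisible), hence the commutators `d u_{ij}(x) d⁻¹ u_{ij}(x)⁻¹ = u_{ij}((d_i d_j⁻¹ - 1) x)`, i.e.
  all transvections, and these with `𝔻ₙ` generate `GL n`
  (Mathlib `Matrix.diagonal_transvection_induction_of_det_ne_zero`).
* `isMaximalTorusIn_diagonalSubgroup_top` — **`𝔻ₙ` is a maximal torus** (7.4.7 (1)): a torus
  containing `𝔻ₙ` is commutative, hence centralises `𝔻ₙ`, hence is diagonal;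
  `isConnectedReductive_top`.
* `Literature.NumberTheory.Automorphic.exists_rootDatum_generalLinearGroup` — **the root datum of `GL n` exists**,
  unconditionally: `(GL n, 𝔻ₙ)` has a reduced root datum `P : RootPairing ι ℤ X Y` with
  `IsRootDatumOf ⊤ 𝔻ₙ P eX eY` (Springer 7.4.7 (1) (c); from
  `exists_isRootDatumOf_generalLinearGroup` and the three theorems above).

## Mathlib

`Matrix.transvection`, `Matrix.diagonal_transvection_induction_of_det_ne_zero`,
`Subgroup.normalCore`, `Subgroup.finiteIndex_normalCore`, `Pi.basisFun`. Mathlib has no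
algebraic groups; nothing here duplicates a Mathlib declaration.

## References

* [SpringerLAG1998] T. A. Springer, *Linear Algebraic Groups*, 2nd ed., Progress in Mathematics 9,
  Birkhäuser (1998): 2.2.2 (1), 2.4.12, 6.3.5, 7.4.7 (1) (b), (c).
-/

open scoped MatrixGroups IsMulCommutative

namespace Literature.NumberTheory.Automorphic

variable {k : Type*} [Field k] {n : Type*} [Fintype n] [DecidableEq n]

/-! ### Elementary matrices -/

section Elementary

/-- The transvection `1 + c E_{ij}` (`i ≠ j`) as an element of `GL n k`. [folklore] -/
def transvectionGL (i j : n) (hij : i ≠ j) (c : k) : GL n k :=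
  (Matrix.SpecialLinearGroup.toGL.comp (transvectionHom i j hij)) (Multiplicative.ofAdd c)

/-- The matrix of `transvectionGL`. [folklore] -/
@[simp] lemma coe_transvectionGL (i j : n) (hij : i ≠ j) (c : k) :
    ((transvectionGL i j hij c : GL n k) : Matrix n n k) = Matrix.transvection i j c := rfl

/-- `u_{ij}(-c) = u_{ij}(c)⁻¹`. [folklore] -/
lemma transvectionGL_neg (i j : n) (hij : i ≠ j) (c : k) :
    transvectionGL i j hij (-c) = (transvectionGL i j hij c)⁻¹ := by
  rw [transvectionGL, transvectionGL, ofAdd_neg, map_inv]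

/-- A matrix with vanishing off-diagonal entries lies in `𝔻ₙ`. [folklore] -/
lemma mem_diagonalSubgroup_of_apply_eq_zero {g : GL n k}
    (h : ∀ i j, i ≠ j → (g : Matrix n n k) i j = 0) : g ∈ diagonalSubgroup n k := by
  have hdiag : (g : Matrix n n k) = Matrix.diagonal fun i => (g : Matrix n n k) i i := by
    ext i j
    by_cases hij : i = j
    · subst hij; simp
    · rw [Matrix.diagonal_apply_ne _ hij, h i j hij]
  have hdet : (g : Matrix n n k).det ≠ 0 := Matrix.det_ne_zero_of_right_inverse g.mul_inv
  rw [hdiag, Matrix.det_diagonal, Finset.prod_ne_zero_iff] at hdet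
  refine ⟨fun i => Units.mk0 ((g : Matrix n n k) i i) (hdet i (Finset.mem_univ i)), Units.ext ?_⟩
  rw [coe_diagonalGL]
  exact hdiag.symm

/-- Over an infinite field there is a unit `a ≠ 1`. [folklore] -/
lemma exists_unit_ne_one [Infinite k] : ∃ a : kˣ, a ≠ 1 := by
  classical
  obtain ⟨c, hc⟩ := Infinite.exists_notMem_finset ({0, 1} : Finset k)
  simp only [Finset.mem_insert, Finset.mem_singleton, not_or] at hc
  exact ⟨Units.mk0 c hc.1, fun h => hc.2 (by simpa using congrArg Units.val h)⟩

end Elementary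

/-! ### `GL n` is reductive (Springer 7.4.7 (1) (b)) -/

section Reductive

/-- **`GL n` is reductive** (Springer 7.4.7 (1) (b): "*show that `G` is reductive*"), over an
algebraically closed field, in the sense of `IsReductiveSubgroup`: a normal subgroup `U` of
`GL n` consisting of unipotent matrices is trivial. Proof: by Kolchin's theorem
(`IsUnipotentSubgroup.exists_mulVec_eq`) the space `W` of common fixed vectors of `U` is
non-zero; it is stable under `GL n` because `U` is normal, hence under the elementary matrices
`E_{ij} = (1 + E_{ij}) - 1`, so contains all basis vectors: `W = kⁿ` and `U = {1}`.
(Connectedness of `U` is not needed.) [cite: SpringerLAG1998, 7.4.7 (1) (b)] -/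
theorem isReductiveSubgroup_top [IsAlgClosed k] : IsReductiveSubgroup (⊤ : Subgroup (GL n k)) := by
  classical
  refine ⟨isAlgebraicSubgroup_top, fun U _ hN _ hunip => ?_⟩
  -- normality in `GL n`
  have hconj : ∀ (g : GL n k), ∀ u ∈ U, g * u * g⁻¹ ∈ U := by
    intro g u hu
    have h := hN.conj_mem ⟨u, Subgroup.mem_top u⟩ (Subgroup.mem_subgroupOf.2 hu)
      ⟨g, Subgroup.mem_top g⟩
    exact Subgroup.mem_subgroupOf.1 h
  rw [eq_bot_iff]
  intro u hu
  rw [Subgroup.mem_bot]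
  cases isEmpty_or_nonempty n with
  | inl _ => exact Units.ext (Subsingleton.elim _ _)
  | inr _ =>
    obtain ⟨v, hv0, hv⟩ := hunip.exists_mulVec_eq
    -- the space of common fixed vectors
    let W : Submodule k (n → k) :=
      { carrier := {w | ∀ u ∈ U, (u : Matrix n n k).mulVec w = w}
        zero_mem' := fun u _ => Matrix.mulVec_zero _
        add_mem' := fun {a b} ha hb u hu => by rw [Matrix.mulVec_add, ha u hu, hb u hu]
        smul_mem' := fun c {a} ha u hu => by rw [Matrix.mulVec_smul, ha u hu] }
    have hmemW : ∀ {w}, w ∈ W ↔ ∀ u ∈ U, (u : Matrix n n k).mulVec w = w := Iff.rfl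
    -- `W` is stable under `GL n`
    have hWg : ∀ (g : GL n k), ∀ w ∈ W, (g : Matrix n n k).mulVec w ∈ W := by
      intro g w hw u' hu'
      have hmem : g⁻¹ * u' * g ∈ U := by simpa using hconj g⁻¹ u' hu'
      have h := (hmemW.1 hw) _ hmem
      calc (u' : Matrix n n k).mulVec ((g : Matrix n n k).mulVec w)
          = ((g * (g⁻¹ * u' * g) : GL n k) : Matrix n n k).mulVec w := by
            rw [Matrix.mulVec_mulVec, ← Units.val_mul, mul_assoc, mul_inv_cancel_left]
        _ = (g : Matrix n n k).mulVec w := by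
            rw [Units.val_mul, ← Matrix.mulVec_mulVec, h]
    -- hence under the elementary matrices `E_{ij}`
    have hE : ∀ (i j : n) (c : k), i ≠ j → ∀ w ∈ W, (Matrix.single i j c).mulVec w ∈ W := by
      intro i j c hij w hw
      have h1 := hWg (transvectionGL i j hij c) w hw
      rw [coe_transvectionGL, Matrix.transvection, Matrix.add_mulVec, Matrix.one_mulVec] at h1
      have h2 := W.sub_mem h1 hw
      rwa [add_sub_cancel_left] at h2
    -- all basis vectors lie in `W`
    obtain ⟨j, hj⟩ : ∃ j, v j ≠ 0 := by
      by_contra! h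
      exact hv0 (funext h)
    have hvW : v ∈ W := hv
    have hothers : ∀ i, i ≠ j → Pi.single i (1 : k) ∈ W := by
      intro i hij
      have h := hE i j ((v j)⁻¹) hij v hvW
      rwa [Matrix.single_mulVec, inv_mul_cancel₀ hj] at h
    have hbasis : ∀ i, Pi.single i (1 : k) ∈ W := by
      intro i
      by_cases hij : i = j
      · subst hij
        by_cases h2 : ∃ i', i' ≠ i
        · obtain ⟨i', hi'⟩ := h2
          have h := hE i i' 1 (Ne.symm hi') _ (hothers i' hi')
          rwa [Matrix.single_mulVec, Pi.single_eq_same, mul_one] at h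
        · have h2' : ∀ i', i' = i := fun i' => by
            by_contra h'
            exact h2 ⟨i', h'⟩
          set c := v i with hc
          have hveq : v = c • Pi.single i (1 : k) := by
            funext i'
            rw [h2' i']
            simp [hc]
          have h := W.smul_mem c⁻¹ hvW
          rw [hveq, smul_smul, inv_mul_cancel₀ hj, one_smul] at h
          exact h
      · exact hothers i hij
    have hWtop : ∀ w, w ∈ W := by
      intro w
      rw [← (Pi.basisFun k n).sum_repr w]
      exact W.sum_mem fun i _ => W.smul_mem _ (by simpa using hbasis i)
    -- so `u` fixes every vector: `u = 1`
    refine Units.ext ?_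
    ext i j'
    have h := congrFun ((hmemW.1 (hWtop (Pi.single j' 1))) u hu) i
    rw [Matrix.mulVec_single_one, Matrix.col_apply] at h
    rw [h, Units.val_one, Matrix.one_apply, Pi.single_apply]

end Reductive

/-! ### `GL n` is Zariski-connected -/

section Connected

/-- **`GL n` is connected** in the sense of `IsZConnected` (no proper algebraic subgroup of
finite index), over an algebraically closed field (Springer 2.2.2 (1) / 2.2.9: `GLₙ` is
connected). Proof at the level of points: a finite-index subgroup `H` contains a normal
finite-index subgroup `N`; `N ⊇ 𝔻ₙ` (`𝔻ₙ` has no finite-index subgroups,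
`eq_diagonalSubgroup_of_finiteIndex`), hence `N` contains the commutators
`d u d⁻¹ u⁻¹ = u_{ij}((d_i d_j⁻¹ - 1) x)`, i.e. all transvections, and transvections and diagonal
matrices generate `GL n` (Mathlib `Matrix.diagonal_transvection_induction_of_det_ne_zero`).
[cite: SpringerLAG1998, 2.2.2 (1)] -/
theorem isZConnected_top [IsAlgClosed k] : IsZConnected (⊤ : Subgroup (GL n k)) := by
  classical
  refine ⟨isAlgebraicSubgroup_top, fun H _ _ hfi => ?_⟩
  haveI : H.FiniteIndex := ⟨by rw [← Subgroup.relIndex_top_right]; exact hfi.index_ne_zero⟩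
  set N := H.normalCore with hN
  have hNn : N.Normal := Subgroup.normalCore_normal H
  -- `𝔻ₙ ≤ N`
  have hD : diagonalSubgroup n k ≤ N := by
    have hfi' : ((N ⊓ diagonalSubgroup n k).subgroupOf (diagonalSubgroup n k)).FiniteIndex := by
      rw [Subgroup.inf_subgroupOf_right]
      infer_instance
    have h := eq_diagonalSubgroup_of_finiteIndex (H := N ⊓ diagonalSubgroup n k) inf_le_right hfi'
    exact inf_eq_right.1 h
  -- transvections lie in `N`
  have hT : ∀ (i j : n) (hij : i ≠ j) (c : k), transvectionGL i j hij c ∈ N := by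
    intro i j hij c
    obtain ⟨a, ha⟩ := exists_unit_ne_one (k := k)
    have ha1 : (a : k) - 1 ≠ 0 := sub_ne_zero.2 fun h => ha (Units.ext h)
    set d : n → kˣ := Function.update 1 i a with hd
    set x : k := c / ((a : k) - 1) with hx
    have hdN : diagonalGL n k d ∈ N := hD ⟨d, rfl⟩
    have hu : transvectionGL i j hij x * (diagonalGL n k d)⁻¹ * (transvectionGL i j hij x)⁻¹ ∈ N := by
      have h := hNn.conj_mem _ (N.inv_mem hdN) (transvectionGL i j hij x)
      exact h
    have hprod := N.mul_mem hdN hu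
    -- `d u(x) d⁻¹ u(x)⁻¹ = u((a - 1) x) = u(c)`
    have hcalc : diagonalGL n k d * (transvectionGL i j hij x * (diagonalGL n k d)⁻¹ *
        (transvectionGL i j hij x)⁻¹) = transvectionGL i j hij c := by
      rw [← transvectionGL_neg, ← map_inv (diagonalGL n k) d]
      apply Units.ext
      simp only [Units.val_mul, coe_transvectionGL, coe_diagonalGL]
      rw [← mul_assoc, ← mul_assoc]
      have hdinv : (fun a' => ((d⁻¹ a' : kˣ) : k)) = fun a' => (((d a')⁻¹ : kˣ) : k) := rfl
      rw [hdinv, diagonal_mul_transvection_mul_diagonal_inv d hij x,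
        Matrix.transvection_mul_transvection_same _ _ hij]
      congr 1
      have hdi : d i = a := by simp [hd]
      have hdj : d j = 1 := by simp [hd, hij.symm]
      rw [hdi, hdj, inv_one, Units.val_one, mul_one, hx]
      field_simp
      ring
    rw [hcalc] at hprod
    exact hprod
  -- transvections and diagonal matrices generate `GL n`
  have hall : ∀ g : GL n k, g ∈ N := by
    intro g
    suffices h : ∀ M : Matrix n n k, M.det ≠ 0 → ∃ g' : GL n k, (g' : Matrix n n k) = M ∧ g' ∈ N by
      obtain ⟨g', hg', hN'⟩ := h g (Matrix.GeneralLinearGroup.det_ne_zero g)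
      have : g' = g := Units.ext hg'
      rwa [this] at hN'
    intro M hM
    refine Matrix.diagonal_transvection_induction_of_det_ne_zero
      (fun M => ∃ g' : GL n k, (g' : Matrix n n k) = M ∧ g' ∈ N) M hM ?_ ?_ ?_
    · intro D hDdet
      rw [Matrix.det_diagonal, Finset.prod_ne_zero_iff] at hDdet
      refine ⟨diagonalGL n k fun i => Units.mk0 (D i) (hDdet i (Finset.mem_univ i)), ?_,
        hD ⟨_, rfl⟩⟩
      rw [coe_diagonalGL]
      rfl
    · intro t
      exact ⟨transvectionGL t.i t.j t.hij t.c, rfl, hT _ _ _ _⟩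
    · rintro A B - - ⟨gA, hA, hAN⟩ ⟨gB, hB, hBN⟩
      exact ⟨gA * gB, by rw [Units.val_mul, hA, hB], N.mul_mem hAN hBN⟩
  exact eq_top_iff.2 fun g _ => Subgroup.normalCore_le H (hall g)

end Connected

/-! ### `𝔻ₙ` is a maximal torus of `GL n` -/

section MaximalTorus

/-- A matrix commuting with all diagonal matrices is diagonal (over a field with a unit `≠ 1`).
[folklore] -/
lemma apply_eq_zero_of_forall_diagonalGL_commute [Infinite k] {g : GL n k}
    (h : ∀ d : n → kˣ, diagonalGL n k d * g = g * diagonalGL n k d) {i j : n} (hij : i ≠ j) :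
    (g : Matrix n n k) i j = 0 := by
  obtain ⟨a, ha⟩ := exists_unit_ne_one (k := k)
  have h1 := congrArg (fun m : GL n k => (m : Matrix n n k) i j) (h (Function.update 1 i a))
  simp only [Units.val_mul, coe_diagonalGL, Matrix.diagonal_mul, Matrix.mul_diagonal,
    Function.update_self, Function.update_of_ne (Ne.symm hij), Pi.one_apply, Units.val_one,
    mul_one] at h1
  -- `a * g i j = g i j`
  have h2 : ((a : k) - 1) * (g : Matrix n n k) i j = 0 := by rw [sub_mul, one_mul, h1, sub_self]
  rcases mul_eq_zero.1 h2 with h3 | h3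
  · exact absurd (Units.ext (sub_eq_zero.1 h3)) ha
  · exact h3

/-- **`𝔻ₙ` is a maximal torus of `GL n`** (Springer 7.4.7 (1): "*`T` is the subgroup of diagonal
matrices*", a maximal torus; 6.3.5–6.3.6), over an algebraically closed field: `𝔻ₙ` is a torus
(`isTorusSubgroup_diagonal_holds`) and a torus `T' ⊇ 𝔻ₙ`, being commutative, centralises `𝔻ₙ`,
hence consists of diagonal matrices. [cite: SpringerLAG1998, 7.4.7 (1)] -/
theorem isMaximalTorusIn_diagonalSubgroup_top [IsAlgClosed k] :
    IsMaximalTorusIn (diagonalSubgroup n k) (⊤ : Subgroup (GL n k)) := by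
  refine ⟨le_top, isTorusSubgroup_diagonal_holds, fun T' hle _ hT' => le_antisymm ?_ hle⟩
  intro t ht
  haveI : IsMulCommutative ↥T' := hT'.2.1
  have hcomm : ∀ d : n → kˣ, diagonalGL n k d * t = t * diagonalGL n k d := fun d =>
    congrArg Subtype.val (mul_comm (⟨diagonalGL n k d, hle ⟨d, rfl⟩⟩ : ↥T') ⟨t, ht⟩)
  exact mem_diagonalSubgroup_of_apply_eq_zero fun i j hij =>
    apply_eq_zero_of_forall_diagonalGL_commute hcomm hij

/-- **`GL n` is a connected reductive group** over an algebraically closed field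
(Springer 7.4.7 (1) (b), 2.2.2 (1)). [cite: SpringerLAG1998, 7.4.7 (1) (b)] -/
theorem isConnectedReductive_top [IsAlgClosed k] : IsConnectedReductive (⊤ : Subgroup (GL n k)) :=
  ⟨isZConnected_top, isReductiveSubgroup_top⟩

end MaximalTorus

end Literature.NumberTheory.Automorphic

/-! ### The root datum of `GL n`, unconditionally -/

namespace Literature.NumberTheory.Automorphic


attribute [local instance] isMulCommutative_diagonalSubgroup

/-- **The root datum of `GL n`** (Springer 7.4.7 (1) (c); lang.S13 (b) for the general linear
group, with all hypotheses discharged): over an algebraically closed field `k`, the pair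
`(GL n, 𝔻ₙ)` *has a reduced root datum* — there are a finite index type `ι`, lattices
`X ≃ X*(𝔻ₙ)`, `Y ≃ X_*(𝔻ₙ)` and a Mathlib root pairing `P : RootPairing ι ℤ X Y` with
`IsRootDatumOf ⊤ 𝔻ₙ P eX eY` and `P.IsReduced` (its roots are the `α_{ij}`,
`roots_top_diagonalSubgroup_eq`). From `exists_isRootDatumOf_generalLinearGroup` (the
computation of 7.4.7 (1)), `isConnectedReductive_top` (`GL n` is connected reductive: Kolchin's
theorem and the generation of `GL n` by transvections and diagonal matrices) and
`isMaximalTorusIn_diagonalSubgroup_top`. [cite: SpringerLAG1998, 7.4.7 (1) (c)] -/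
theorem exists_rootDatum_generalLinearGroup {k : Type*} [Field k] [IsAlgClosed k] {n : Type*}
    [Fintype n] [DecidableEq n] :
    ∃ (ι X Y : Type) (_ : Fintype ι) (_ : AddCommGroup X) (_ : AddCommGroup Y)
      (P : RootPairing ι ℤ X Y)
      (eX : Additive ↥(characterLattice (diagonalSubgroup n k)) ≃+ X)
      (eY : Additive ↥(cocharacterLattice (diagonalSubgroup n k)) ≃+ Y),
      IsRootDatumOf (⊤ : Subgroup (GL n k)) (diagonalSubgroup n k) P eX eY ∧ P.IsReduced :=
  exists_isRootDatumOf_generalLinearGroup isConnectedReductive_top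
    isMaximalTorusIn_diagonalSubgroup_top

end Literature.NumberTheory.Automorphic
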